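import Summits.ResolutionOfSingularities.ResolutionOfSingularities.Theorems.NearExitChartAux

/-!
# Near exit — the chart theorem (campaign «NearExit», g33, file 11)

THE CHART-LEVEL MASTER THEOREM `two_le_tau_chart`: `R` regular local of dimension `d + 1` with regular system of
parameters `c`, `J ∋ f = c₀ⁿ + G(c)` (`G` a form of degree `n + 1`, `n ≥ 2`) of class `HasNearGenericFace c J n`;
`𝔴` a prime of the Rees chart `S = R[c/c_j]` over `𝔪_R`, `L = S_𝔴` (any localisation, given by `χ : S → L`,
`σ = χ ∘ (R → S)`), `J′ ⊆ 𝔪_Lⁿ` an ideal containing every `h` with `σ(c_j)ⁿ·h ∈ JL` (the controlled transform at a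
near point).  THEN `τ(J′, n) ≥ 2` in every minimal basis of `𝔪_L`.

Proof (module docstrings of the kernel files): unit cases (S1) force `j ≠ 0`, `e₀ = c₀/c_j ∈ 𝔴`; the `τ`-kernel
K1 (`NearExitTau`) turns `τ ≤ 1` into `Φ ∈ (e₀, c_j) + 𝔪_Lⁿ` for the face element `Φ = G^{σ}(0, e₁, …)`; at a
RATIONAL point of the strict transform of a listed direction `w_i` (`w_{ij}` a unit and all `e_k w_{ij} − w_{ik} ∈ 𝔴`)
the kernel R (`NearExitRational.persists_of_rational`, fed by `NearExitChartAux.isRsopPart_rational` /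
`exists_sub_mem_rational`) produces `Persists c w_i t_i J n`, contradicting clause (iii); at every other point
(`false_of_generic_point`) the fibre transfer (`NearExitTransfer`) and the generic-point contradiction
(`NearExitGeom.false_of_generic`) contradict clause (ii).

Sources: [CossartPiltant2008] Prop. 4.2; [Hironaka1970] Thms. 2, 3; [DeJong1996] 2.4; [StacksProject] Tag 0BIQ.
-/

open IsLocalRing MvPolynomial
open Literature.AlgebraicGeometry.Resolution
open Summit.ResolutionOfSingularities.ResolutionOfSingularities.Theorems.PinchTower

namespace Summit.ResolutionOfSingularities.ResolutionOfSingularities.Theorems.NearExit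

section Chart

variable {R : Type} [CommRing R] [IsRegularLocalRing R] {d : ℕ} (c : Fin (d + 1) → R)
  (hc : Ideal.span (Set.range c) = maximalIdeal R) (hd : (maximalIdeal R).spanFinrank = d + 1)

include hc hd in
/-- **Non-rational points.**  At a prime `𝔴 ∋ e₀` of the chart `j ≠ 0` over `𝔪_R` which is NOT a rational point
of the strict transform of a listed direction, the K1-conclusion `Φ ∈ (e₀, c_j) + 𝔪ⁿ S_𝔴` contradicts the
genericity clause (ii) of `HasNearGenericFace`. [cite: CossartPiltant2008, Prop. 4.2] [cite: Hironaka1970, Thm. 3] -/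
theorem false_of_generic_point (j : Fin (d + 1)) (𝔴 : Ideal (chartRing c j)) [𝔴.IsPrime]
    (h𝔴 : 𝔴.comap (chartBase c j) = maximalIdeal R) (L : Type) [CommRing L] [IsLocalRing L]
    [Algebra (chartRing c j) L] [IsLocalization.AtPrime L 𝔴] (hj : j ≠ 0) (he0 : chartGen c j 0 ∈ 𝔴)
    {n : ℕ} (hn : 2 ≤ n) (G : MvPolynomial (Fin (d + 1)) R) (hG : G.IsHomogeneous (n + 1))
    (hK1 : (algebraMap (chartRing c j) L : chartRing c j →+* L)
        (MvPolynomial.eval (Function.update (chartGen c j) 0 0) (MvPolynomial.map (chartBase c j) G)) ∈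
      Ideal.span (Set.range (![(algebraMap (chartRing c j) L : chartRing c j →+* L) (chartGen c j 0),
        (algebraMap (chartRing c j) L : chartRing c j →+* L) (chartBase c j (c j))] : Fin 2 → L)) ⊔
        maximalIdeal L ^ n)
    {m' : ℕ} (w : Fin m' → Fin (d + 1) → R)
    (hR : ¬ ∃ i, IsUnit (w i j) ∧ ∀ k, chartGen c j k * chartBase c j (w i j) - chartBase c j (w i k) ∈ 𝔴)
    (hgen : ∀ v : Fin (d + 1) → AlgebraicClosure (ResidueField R), v ≠ 0 → v 0 = 0 →
      FaceFormCutClasses.MultLT (VeryNearCutClasses.geomFace G) v (VeryNearCutClasses.nearThreshold n) ∨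
        ∃ i, VeryNearCutClasses.Matches (w i) v) : False := by
  have hz0 := -- WRITER NOTE (g16): landed twin cited by name (dedup p837315)
    Summit.ResolutionOfSingularities.ResolutionOfSingularities.Cruxes.SigmaMaxModifications.IdeasL1C5.EmbeddedStep.span_range_append_elim0 c hc
  have hd0 := spanFinrank_eq_add_zero (R := R) hd
  have hqr : IsQuasiRegular c := isQuasiRegular_centre c (Fin.elim0 : Fin 0 → R) hz0 hd0
  obtain ⟨s, hs, hsΦ⟩ := exists_mul_fibreFace_mem_pow c hc hqr j 𝔴 h𝔴 L hj he0 G n hK1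
  have h𝔮 : (𝔴.map (fibreMap c hc hqr j)).IsPrime := isPrime_fibrePrime c hc hqr j 𝔴 h𝔴
  have hX0 : (X ⟨0, Ne.symm hj⟩ : MvPolynomial {k : Fin (d + 1) // k ≠ j} (ResidueField R)) ∈
      𝔴.map (fibreMap c hc hqr j) := by
    rw [← fibreMap_chartGen c hc hqr j (Ne.symm hj)]
    exact (mem_iff_fibreMap_mem c hc hqr j 𝔴 h𝔴 _).mp he0
  refine false_of_generic (κ := ResidueField R) (Ω := AlgebraicClosure (ResidueField R)) j hj
    (MvPolynomial.map (residue R) G) (hG.map (residue R)) (𝔴.map (fibreMap c hc hqr j)) h𝔮 hX0 hs hsΦ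
    (fun i k => residue R (w i k)) (fun i hij => fibre_hM c hc hqr j 𝔴 h𝔴 w i
      (fun hall' => hR ⟨i, (IsLocalRing.residue_ne_zero_iff_isUnit _).mp hij, hall'⟩) hij) ?_
  intro v hv hv0
  rcases hgen v hv hv0 with h | ⟨i, a, ha, hav⟩
  · left
    unfold VeryNearCutClasses.geomFace VeryNearCutClasses.nearThreshold at h
    rw [max_eq_right hn] at h
    exact h
  · right
    exact ⟨i, a, ha, hav⟩

include hc hd in
/-- **THE CHART THEOREM.**  See the module docstring. [cite: CossartPiltant2008, Prop. 4.2]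
[cite: Hironaka1970, Thms. 2, 3] -/
theorem two_le_tau_chart (J : Ideal R) {n : ℕ} (hn : 2 ≤ n) (hface : VeryNearCutClasses.HasNearGenericFace c J n)
    (j : Fin (d + 1)) (𝔴 : Ideal (chartRing c j)) [𝔴.IsPrime] (h𝔴 : 𝔴.comap (chartBase c j) = maximalIdeal R)
    (L : Type) [CommRing L] [IsLocalRing L] (σ : R →+* L) (χ : chartRing c j →+* L)
    (hχ : ∀ r, χ (chartBase c j r) = σ r) (hloc : @IsLocalization.AtPrime _ _ L _ χ.toAlgebra 𝔴 _)
    (J' : Ideal L) (hcol : ∀ h : L, σ (c j) ^ n * h ∈ J.map σ → h ∈ J') (hnear : J' ≤ maximalIdeal L ^ n)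
    {m : ℕ} (x : Fin m → L) (hx : Ideal.span (Set.range x) = maximalIdeal L) :
    2 ≤ hironakaTauAt x J' n := by
  classical
  letI alg : Algebra (chartRing c j) L := χ.toAlgebra
  haveI : IsLocalization.AtPrime L 𝔴 := hloc
  haveI : IsNoetherianRing (chartRing c j) := isNoetherianRing_blowupChart c j
  haveI : IsNoetherianRing L := IsLocalization.isNoetherianRing 𝔴.primeCompl L inferInstance
  have halg : ∀ w, algebraMap (chartRing c j) L w = χ w := fun w => by rw [RingHom.algebraMap_toAlgebra]
  have hχm : ∀ a ∈ 𝔴, χ a ∈ maximalIdeal L := fun a ha => by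
    rw [← halg]; exact (IsLocalization.AtPrime.to_map_mem_maximal_iff L 𝔴 a).mpr ha
  have hχu : ∀ a ∉ 𝔴, IsUnit (χ a) := fun a ha => by
    rw [← halg]; exact IsLocalization.map_units L (⟨a, ha⟩ : 𝔴.primeCompl)
  have hKw : chartBase c j (c j) ∈ 𝔴 := by
    rw [← Ideal.mem_comap, h𝔴, ← hc]; exact Ideal.subset_span ⟨j, rfl⟩
  have htm : σ (c j) ∈ maximalIdeal L := by rw [← hχ]; exact hχm _ hKw
  obtain ⟨G, hG, hfJ, m', w, τ, hτ, hgen, hnp⟩ := hface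
  by_contra hlt
  have hτ1 : hironakaTauAt x J' n ≤ 1 := by omega
  -- the chart coordinates `z_k = χ(e_k)` and `σ(c_k) = σ(c_j) z_k`
  obtain ⟨z, hz⟩ : ∃ z : Fin (d + 1) → L, ∀ k, z k = χ (chartGen c j k) := ⟨_, fun _ => rfl⟩
  have hzf : (fun k => χ (chartGen c j k)) = z := funext fun k => (hz k).symm
  have hσc : ∀ k, σ (c k) = σ (c j) * z k := fun k => by rw [hz k]; exact sigma_apply_eq c j σ χ hχ k
  -- the transform `f' = z₀ⁿ + σ(c_j)·E ∈ J'`, `E = G^{σ}(z)`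
  have hE2 : σ (c 0 ^ n + MvPolynomial.eval c G) =
      σ (c j) ^ n * (z 0 ^ n + σ (c j) * MvPolynomial.eval z (MvPolynomial.map σ G)) := by
    rw [map_add, map_pow, map_eval_eq_eval_map σ c G, hσc 0]
    have hfun : (σ ∘ c) = fun k => σ (c j) * z k := funext fun k => by rw [Function.comp_apply, hσc k]
    rw [hfun, eval_mul_of_isHomogeneous (σ (c j)) z (hG.map σ)]; ring
  have hf' : z 0 ^ n + σ (c j) * MvPolynomial.eval z (MvPolynomial.map σ G) ∈ J' :=
    hcol _ (by rw [← hE2]; exact Ideal.mem_map_of_mem σ hfJ)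
  -- `E = Φ + z₀ H`, `Φ = G^{σ}(0, z₁, …)`
  have hdec := aeval_sub_aeval_mem_span (MvPolynomial.map σ G) z (Function.update z 0 0) 0
    (fun k hk => by rw [Function.update_of_ne hk])
  rw [Function.update_self, sub_zero, MvPolynomial.aeval_eq_eval, MvPolynomial.aeval_eq_eval] at hdec
  obtain ⟨H, hH⟩ := Ideal.mem_span_singleton'.mp hdec
  have hEΦ : MvPolynomial.eval z (MvPolynomial.map σ G) =
      MvPolynomial.eval (Function.update z 0 0) (MvPolynomial.map σ G) + z 0 * H := by
    linear_combination (-1 : L) * hH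
  have hmem := hf'
  rw [hEΦ] at hmem
  -- (S1) unit cases: `z₀ ∈ 𝔪_L`, hence `e₀ ∈ 𝔴` and `j ≠ 0`
  have hx0m : z 0 ∈ maximalIdeal L := by
    have h2 : z 0 ^ n + σ (c j) * MvPolynomial.eval z (MvPolynomial.map σ G) ∈ maximalIdeal L :=
      Ideal.pow_le_self (by omega) (hnear hf')
    have h3 := (maximalIdeal L).sub_mem h2
      (Ideal.mul_mem_right (MvPolynomial.eval z (MvPolynomial.map σ G)) _ htm)
    rw [add_sub_cancel_right] at h3
    exact (IsLocalRing.maximalIdeal.isMaximal L).isPrime.mem_of_pow_mem n h3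
  have he0 : chartGen c j 0 ∈ 𝔴 := by
    by_contra h
    have hu := hχu _ h
    rw [← hz 0] at hu
    exact (IsLocalRing.mem_maximalIdeal _).mp hx0m hu
  have hj0 : (0 : Fin (d + 1)) ≠ j := by
    intro h0j
    apply (IsLocalRing.maximalIdeal.isMaximal L).ne_top
    rw [Ideal.eq_top_iff_one]
    have h1 : chartGen c j 0 = 1 := by rw [h0j]; exact chartGen_self c j
    have h2 := hx0m
    rw [hz 0, h1, map_one] at h2
    exact h2
  have hj : j ≠ 0 := fun h => hj0 h.symm
  -- the pair `(z₀, σ c_j)` is part of a regular system of parameters of `L`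
  have hxt : IsRsopPart ![z 0, σ (c j)] := by
    rw [hz 0]; exact isRsopPart_pair c hc hd j 𝔴 h𝔴 L σ χ hχ hloc hj0 he0
  -- (K1)
  have hK1 := face_mem_of_tau_le_one hxt hn hmem hnear x hx hτ1
  have hΦχ : χ (MvPolynomial.eval (Function.update (chartGen c j) 0 0) (MvPolynomial.map (chartBase c j) G)) =
      MvPolynomial.eval (Function.update z 0 0) (MvPolynomial.map σ G) := by
    rw [chi_face_eq c j σ χ hχ G, hzf]
  -- case split: rational point of the strict transform of a listed direction, or not
  by_cases hR : ∃ i, IsUnit (w i j) ∧ ∀ k, chartGen c j k * chartBase c j (w i j) - chartBase c j (w i k) ∈ 𝔴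
  · -- CASE (R): a rational point of the strict transform of the listed direction `w i`
    obtain ⟨i, hunit, hall⟩ := hR
    obtain ⟨υi, hυi⟩ := hunit.exists_right_inv
    have hυiu : IsUnit υi := IsUnit.of_mul_eq_one (w i j) (by rw [mul_comm]; exact hυi)
    obtain ⟨ŵ, hŵ⟩ : ∃ ŵ : Fin (d + 1) → R, ŵ = fun k => w i k * υi := ⟨_, rfl⟩
    have hŵj : ŵ j = 1 := by rw [hŵ]; exact hυi
    have hcBw : ∀ k, chartGen c j k - chartBase c j (ŵ k) ∈ 𝔴 := fun k => by
      rw [hŵ]; exact chartGen_sub_mem c j 𝔴 h𝔴 hunit hall hυi k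
    have hŵ0 : ŵ 0 ∈ maximalIdeal R := mem_maximalIdeal_of_chartGen_mem c j 𝔴 h𝔴 ŵ hcBw he0
    -- the coordinates `y` of the rational point
    obtain ⟨yv, hyv⟩ : ∃ yv : Fin (d + 1) → L,
        yv = Function.update (fun k => χ (chartGen c j k) - σ (ŵ k)) j 0 := ⟨_, rfl⟩
    have hyj : yv j = 0 := by rw [hyv, Function.update_self]
    have hy : ∀ k, k ≠ j → σ (c k - ŵ k * c j) = σ (c j) * yv k := fun k hk => by
      rw [hyv, Function.update_of_ne hk, map_sub, map_mul, hσc k, hz k]; ring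
    have hrsop : IsRsopPart (Function.update yv j (σ (c j))) := by
      rw [hyv, Function.update_idem]
      exact isRsopPart_rational c hc hd j 𝔴 h𝔴 L σ χ hχ hloc ŵ hcBw
    have hres := exists_sub_mem_rational c hc j 𝔴 h𝔴 L σ χ hχ hloc ŵ hcBw
    -- KERNEL R: the listed direction persists — contradiction with clause (iii)
    have hN : VeryNearCutClasses.nIdeal c ŵ = VeryNearCutClasses.nIdeal c (w i) := by
      rw [hŵ, nIdeal_mul_unit c (w i) hυiu]
    have hP := persists_of_rational σ c hc j hj ŵ hŵj hŵ0 yv hyj hy hrsop hres (by omega : 1 ≤ n) hcol hnear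
      x hx hτ1 hG hfJ (τ i) (hτ i).1 (by rw [hN]; exact (hτ i).2)
    exact hnp i ((persists_iff_of_nIdeal_eq c hN (τ i) J n).mp hP)
  · -- CASE (G): fibre transfer and the generic-point contradiction with clause (ii)
    have hK1' : (algebraMap (chartRing c j) L : chartRing c j →+* L)
        (MvPolynomial.eval (Function.update (chartGen c j) 0 0) (MvPolynomial.map (chartBase c j) G)) ∈
        Ideal.span (Set.range (![(algebraMap (chartRing c j) L : chartRing c j →+* L) (chartGen c j 0),
          (algebraMap (chartRing c j) L : chartRing c j →+* L) (chartBase c j (c j))] : Fin 2 → L)) ⊔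
          maximalIdeal L ^ n := by
      rw [halg, halg, halg, hΦχ, hχ, ← hz 0]; exact hK1
    exact false_of_generic_point c hc hd j 𝔴 h𝔴 L hj he0 hn G hG hK1' w hR hgen

end Chart

end Summit.ResolutionOfSingularities.ResolutionOfSingularities.Theorems.NearExit
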